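import Summits.RiemannHypothesis.RiemannHypothesis.Theorems.Splittings.ScrewNullCombDecay
import Summits.RiemannHypothesis.RiemannHypothesis.Theorems.Splittings.ScrewNullCombOnline
import Summits.RiemannHypothesis.RiemannHypothesis.Theorems.Splittings.ScrewNullCombLandau

/-!
# Splittings — SCREW NULL COMBINATIONS VI: NNC given finitely many off-line zeros (assembly)

Cell rh-split (brief sha16 f79c5f09d8bcb036), seat rh-split-typer-2 g3 (prover; own initiative on the cross/screw column,
announced HOME/STATUS.md 01:50Z): residual **R2** of target T2 (`ETAIL ⟺ FOZ`) of `cards/SPLIT-screw-bridge.md` §8/§9.  The seat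
rh-split-screw-bridge g4 re-expressed R2 («FOZ ⟹ the screw Gram matrices are eventually nonsingular») as «FOZ ⟹ NNC»,
NNC = «no non-zero finite real combination `t ↦ Σ_{j<n} z_j G_g(t, log(j+2))` of kernel sections vanishes at every node
`log(i+2)`» (`Splittings/ScrewBridgeRigidity.lean`, `inertiaOfFoz_iff_foz_imp_nnc`).  This file is part VI of VI, the assembly:
`nnc_of_finite_offline` — if only finitely many non-trivial zeros lie off the critical line, NO non-zero finite real combination
of screw-kernel sections vanishes at every node (steps (i)–(iv) of parts II–V).  The hypothesis is VERBATIM the body of the route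
decl `Theses.RuelleBand.CofiniteCriticalLine` (FOZ) and the conclusion is VERBATIM the hypothesis `hnnc` of
`ScrewBridgeRigidity.fozNonsingular_of_nnc`; the corollaries «FOZ ⟹ screw matrices eventually nonsingular» (R2) and
«FOZ ⟹ ETAIL» (`InertiaOfFoz`) are drawn in the companion file that imports the screw-bridge cone.  Under RH the statement is
trivial (the screw matrices are positive definite); the content is the FOZ ∧ ¬RH case, where Suzuki 2023 Thm 1.4 says the
continuum form DOES degenerate at some finite window — degeneracy at EVERY large node level is what is excluded here.  [new]

HONEST LABEL: an RH-free theorem about Suzuki's screw kernel GIVEN finitely many off-line zeros; it discharges the residual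
R2 of a CONDITIONAL bridge (cell rh-split: «SPLITTING SEARCH over kernel-typed RH-EQUIVALENCES; a splitting A ∧ B ⟹ RH is
CONDITIONAL bookkeeping unless A and B are both proved») and nothing here bears on the truth of RH.
-/

set_option linter.dupNamespace false

noncomputable section

namespace Summit.RiemannHypothesis.RiemannHypothesis.Theorems.Splittings.ScrewNullComb


open Filter Topology Complex Finset
open Literature.NumberTheory.LFunctions

/-- **NNC given finitely many off-line zeros.**  If only finitely many non-trivial zeros of `ζ` lie off the critical
line, then no non-zero finite real combination `t ↦ Σ_{j<n} z_j G_g(t, log(j+2))` of sections of Suzuki's screw kernel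
`G_g(t,u) = Ψ(t) + Ψ(u) − Ψ(t−u)` vanishes at every node `t = log(i+2)`, `i ∈ ℕ`.
Proof: (i) node vanishing + the prime-side Lipschitz bound give `F(t) → 0` (`tendsto_nodeComb_zero`); (ii) Suzuki's
series (1.9) expands `F(t) = Σ_ρ a(ρ)e^{(ρ−½)t} − A₀` with `a(ρ) = m(ρ)(ρ−½)^{-2} R_z(ρ−½)` (`hasSum_nodeComb`);
(iii) the finitely many growing terms and then the almost-periodic on-line part force `a(ρ) = 0` for `Re ρ ≥ ½`
(`coeff_eq_zero_of_tendsto_zeros`), i.e. `R_z(ρ−½) = 0` at every on-line zero; (iv) Landau–Gonek and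
Riemann–von Mangoldt give `z = 0` (`eq_zero_of_R_vanish_online`). RH-free; unconditional GIVEN the finiteness. [new] -/
theorem nnc_of_finite_offline
    (hfin : Set.Finite {s : ℂ | riemannZeta s = 0 ∧ 0 < s.re ∧ s.re < 1 ∧ s.re ≠ 1 / 2}) :
    ∀ n : ℕ, ∀ z : Fin n → ℝ,
      (∀ i : ℕ, ∑ j : Fin n, zetaScrewKernel (Real.log ((i + 2 : ℕ) : ℝ))
        (Real.log (((j : ℕ) + 2 : ℕ) : ℝ)) * z j = 0) → z = 0 := by
  intro n z hz
  -- the coefficients `a(ρ)`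
  set a : ZetaZeros.riemannZetaNontrivialZeros → ℂ := fun ρ ↦
      (riemannZetaZeroOrder (ρ : ℂ) : ℂ) / ((ρ : ℂ) - 1 / 2) ^ 2 *
        ∑ j : Fin n, (z j : ℂ) * (1 - Complex.exp (-(((ρ : ℂ) - 1 / 2) * (Real.log (((j : ℕ) + 2 : ℕ) : ℝ) : ℂ))))
    with ha
  have ha_s : Summable fun ρ ↦ ‖a ρ‖ := summable_norm_coeff n z
  set A₀ : ℂ := ∑' ρ, a ρ with hA₀
  -- (i) + (ii): the expansion tends to `0`
  have hexp : ∀ t : ℝ, ((∑ j : Fin n, zetaScrewKernel t (Real.log (((j : ℕ) + 2 : ℕ) : ℝ)) * z j : ℝ) : ℂ) =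
      (∑' ρ : ZetaZeros.riemannZetaNontrivialZeros, a ρ * Complex.exp (((ρ : ℂ) - 1 / 2) * t)) - A₀ := by
    intro t
    have h1 := hasSum_nodeComb n z t
    have h2 := ((summable_coeff_mul_exp n z t).hasSum.sub (summable_coeff n z).hasSum)
    refine h1.unique (h2.congr_fun fun ρ ↦ ?_)
    ring
  have hT : Tendsto (fun t : ℝ ↦ (∑' ρ : ZetaZeros.riemannZetaNontrivialZeros,
      a ρ * Complex.exp (((ρ : ℂ) - 1 / 2) * t)) - A₀) atTop (𝓝 0) := by
    have h := (tendsto_nodeComb_zero n z hz).ofReal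
    rw [Complex.ofReal_zero] at h
    exact h.congr fun t ↦ hexp t
  -- (iii): the on-line coefficients vanish
  have hO : Set.Finite {ρ : ZetaZeros.riemannZetaNontrivialZeros | (ρ : ℂ).re ≠ 1 / 2} := by
    refine (hfin.preimage Subtype.val_injective.injOn).subset fun ρ hρ ↦ ?_
    exact ⟨ZetaZeros.riemannZetaNontrivialZeros.zeta_eq_zero ρ.2, ZetaZeros.riemannZetaNontrivialZeros.re_pos ρ.2,
      ZetaZeros.riemannZetaNontrivialZeros.re_lt_one ρ.2, hρ⟩
  obtain ⟨-, honline⟩ := coeff_eq_zero_of_tendsto_zeros a ha_s hO A₀ hT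
  -- hence `R_z(ρ − ½) = 0` at every on-line zero
  have hR : ∀ ρ : ℂ, ρ ∈ ZetaZeros.riemannZetaNontrivialZeros → ρ.re = 1 / 2 →
      ∑ j : Fin n, (z j : ℂ) * (1 - Complex.exp (-((ρ - 1 / 2) * (Real.log (((j : ℕ) + 2 : ℕ) : ℝ) : ℂ)))) = 0 := by
    intro ρ hρ hre
    have h := honline ⟨ρ, hρ⟩ hre
    simp only [ha] at h
    rcases mul_eq_zero.1 h with h1 | h1
    · exfalso
      refine div_ne_zero ?_ (pow_ne_zero 2 (sub_half_ne_zero ⟨ρ, hρ⟩)) h1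
      exact_mod_cast (zeroOrder_pos ⟨ρ, hρ⟩).ne'
    · exact h1
  -- (iv): Landau–Gonek
  exact eq_zero_of_R_vanish_online n z hfin hR

end Summit.RiemannHypothesis.RiemannHypothesis.Theorems.Splittings.ScrewNullComb

end
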